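import Summits.Ventures.Crystal3D.Bulk.RotSysCounts
import HarnessLib

/-!
# Cycles of a permutation multiplied by a transposition (merge / split), and the class count
# (generic brick for (G1c)(F) of `phase2/LEAN-FACES-DESIGN.md` §5.4)

HONEST FRAMING. Part of the venture `Summits/Ventures/Crystal3D` (cell `pub-crystal3d`, phase 2;
seat typer-bulk-2), PURELY COMBINATORIAL and generic (folklore; the three `…mul_swap…` lemmas are
adapted from `Summits/PneNP/PneNP/Theorems/SymmetryBudgetHamCompilesStubKotzigAux.lean`, re-proved
here to avoid a cross-summit import). For a permutation `π` of a finite type and `a, b`: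

* `pow_mul_swap_apply`, **`sameCycle_mul_swap_iff`** (if `a, b` lie in DIFFERENT cycles of `π`,
  the cycle of `a` under `π * swap a b` is the union of the two),
  `sameCycle_mul_swap_iff_of_not_sameCycle` (the other cycles are unchanged);
* **`not_sameCycle_swap_mul_of_sameCycle`**: if `a ≠ b` lie in the SAME cycle of `π`, then they
  lie in different cycles of `swap a b * π` (the split);
* `sameCycle_swap_mul_iff_merge`: the relation `SameCycle (swap a b * π)` in terms of
  `SameCycle π` when `a, b` are in different `π`-cycles (left-multiplication form);
* the class counts are in the sequel `Bulk/RotSysMerge.lean`.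

Nothing here mentions GAP(1.26).
-/

namespace Summit.Ventures.Crystal3D

namespace RotSys

open Equiv Equiv.Perm Finset

variable {D : Type*} [DecidableEq D]

/-! ## Right multiplication by a transposition of two points in different cycles (merge) -/

/-- Along the orbit of `b`: the powers of `π * swap a b` at `a` follow the `π`-orbit of `b` up to
its period (when `a`, `b` lie in different cycles).
(adapted from Summits/PneNP/…/SymmetryBudgetHamCompilesStubKotzigAux.lean) -/
theorem pow_mul_swap_apply (π : Perm D) {a b : D} (hab : ¬ π.SameCycle a b) :
    ∀ k, 1 ≤ k → k ≤ Function.minimalPeriod π b → ((π * swap a b) ^ k) a = (π ^ k) b := by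
  intro k hk hkp
  induction k with
  | zero => omega
  | succ k ih =>
    rcases Nat.eq_zero_or_pos k with rfl | hpos
    · simp
    · rw [pow_succ', Perm.mul_apply, ih hpos (by omega), pow_succ', Perm.mul_apply, Perm.mul_apply]
      congr 1
      apply swap_apply_of_ne_of_ne
      · intro h
        exact hab (SameCycle.symm ⟨k, by rw [zpow_natCast, h]⟩)
      · intro h
        have hper : Function.IsPeriodicPt π k b := by
          unfold Function.IsPeriodicPt Function.IsFixedPt
          rw [← Equiv.Perm.iterate_eq_pow] at h
          exact h
        have := hper.minimalPeriod_le hpos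
        omega

/-- Outside the cycles of `a` and `b`, `π * swap a b` acts like `π`.
(adapted from Summits/PneNP/…/SymmetryBudgetHamCompilesStubKotzigAux.lean) -/
theorem pow_mul_swap_apply_of_not_sameCycle (π : Perm D) {a b z : D} (ha : ¬ π.SameCycle a z)
    (hb : ¬ π.SameCycle b z) (k : ℕ) : ((π * swap a b) ^ k) z = (π ^ k) z := by
  induction k with
  | zero => simp
  | succ k ih =>
    rw [pow_succ', Perm.mul_apply, ih, pow_succ', Perm.mul_apply, Perm.mul_apply]
    congr 1
    apply swap_apply_of_ne_of_ne
    · intro h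
      exact ha (SameCycle.symm ⟨k, by rw [zpow_natCast, h]⟩)
    · intro h
      exact hb (SameCycle.symm ⟨k, by rw [zpow_natCast, h]⟩)

variable [Fintype D]

omit [DecidableEq D] in
/-- Every point of a permutation of a finite type has positive minimal period. -/
theorem minimalPeriod_pos_perm (π : Perm D) (x : D) : 0 < Function.minimalPeriod π x :=
  Function.minimalPeriod_pos_of_mem_periodicPts (π.injective.mem_periodicPts x)

omit [DecidableEq D] in
/-- In a finite type, `SameCycle` is witnessed by a power below the minimal period. -/
theorem SameCycle.exists_lt_minimalPeriod {π : Perm D} {x y : D} (h : π.SameCycle x y) :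
    ∃ k < Function.minimalPeriod π x, (π ^ k) x = y := by
  obtain ⟨k, hk⟩ := h.exists_nat_pow_eq
  refine ⟨k % Function.minimalPeriod π x, Nat.mod_lt _ (minimalPeriod_pos_perm π x), ?_⟩
  have := Function.iterate_mod_minimalPeriod_eq (f := π) (x := x) (n := k)
  rw [Equiv.Perm.iterate_eq_pow, Equiv.Perm.iterate_eq_pow] at this
  rw [this, hk]

/-- **Merging lemma.** If `a` and `b` lie in different cycles of `π`, the cycle of `a` under
`π * swap a b` is the union of the two cycles.
(adapted from Summits/PneNP/…/SymmetryBudgetHamCompilesStubKotzigAux.lean) -/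
theorem sameCycle_mul_swap_iff (π : Perm D) {a b : D} (hab : ¬ π.SameCycle a b) (z : D) :
    (π * swap a b).SameCycle a z ↔ π.SameCycle a z ∨ π.SameCycle b z := by
  set pa := Function.minimalPeriod π a
  set pb := Function.minimalPeriod π b
  have hpa : 0 < pa := minimalPeriod_pos_perm π a
  have hpb : 0 < pb := minimalPeriod_pos_perm π b
  have hA := pow_mul_swap_apply π hab
  have hB : ∀ k, 1 ≤ k → k ≤ pa → ((π * swap a b) ^ k) b = (π ^ k) a := by
    have := pow_mul_swap_apply π (fun h => hab h.symm)
    rw [swap_comm] at this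
    exact this
  have hpb' : ((π * swap a b) ^ pb) a = b := by
    rw [hA pb hpb le_rfl]
    have := Function.iterate_minimalPeriod (f := π) (x := b)
    rwa [Equiv.Perm.iterate_eq_pow] at this
  have hpa' : ((π * swap a b) ^ pa) b = a := by
    rw [hB pa hpa le_rfl]
    have := Function.iterate_minimalPeriod (f := π) (x := a)
    rwa [Equiv.Perm.iterate_eq_pow] at this
  have hper : ((π * swap a b) ^ (pa + pb)) a = a := by
    rw [pow_add, Perm.mul_apply, hpb', hpa']
  constructor
  · intro h
    obtain ⟨k, hk⟩ := h.exists_nat_pow_eq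
    have hp : Function.IsPeriodicPt (π * swap a b) (pa + pb) a := by
      unfold Function.IsPeriodicPt Function.IsFixedPt
      rw [Equiv.Perm.iterate_eq_pow]
      exact hper
    have hk' : ((π * swap a b) ^ (k % (pa + pb))) a = z := by
      have := hp.iterate_mod_apply k
      rw [Equiv.Perm.iterate_eq_pow, Equiv.Perm.iterate_eq_pow] at this
      rw [this, hk]
    set r := k % (pa + pb) with hr
    have hrlt : r < pa + pb := Nat.mod_lt _ (by omega)
    by_cases hr0 : r = 0
    · left
      rw [hr0, pow_zero, Perm.one_apply] at hk'
      exact hk' ▸ SameCycle.rfl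
    by_cases hrb : r ≤ pb
    · right
      rw [hA r (by omega) hrb] at hk'
      exact ⟨r, by rw [zpow_natCast, hk']⟩
    · left
      obtain ⟨j, hj⟩ : ∃ j, r = j + pb := ⟨r - pb, by omega⟩
      rw [hj, pow_add, Perm.mul_apply, hpb', hB j (by omega) (by omega)] at hk'
      exact ⟨j, by rw [zpow_natCast, hk']⟩
  · rintro (h | h)
    · obtain ⟨r, hr, hk⟩ := SameCycle.exists_lt_minimalPeriod h
      by_cases hr0 : r = 0
      · rw [hr0, pow_zero, Perm.one_apply] at hk
        exact hk ▸ SameCycle.rfl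
      · have : ((π * swap a b) ^ (r + pb)) a = z := by
          rw [pow_add, Perm.mul_apply, hpb', hB r (by omega) hr.le, hk]
        exact ⟨(r + pb : ℕ), by rw [zpow_natCast, this]⟩
    · obtain ⟨r, hr, hk⟩ := SameCycle.exists_lt_minimalPeriod h
      by_cases hr0 : r = 0
      · rw [hr0, pow_zero, Perm.one_apply] at hk
        exact ⟨pb, by rw [zpow_natCast, hpb', hk]⟩
      · exact ⟨r, by rw [zpow_natCast, hA r (by omega) hr.le, hk]⟩

/-- Outside the cycles of `a` and `b`, the cycles of `π * swap a b` are those of `π`.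
(adapted from Summits/PneNP/…/SymmetryBudgetHamCompilesStubKotzigAux.lean) -/
theorem sameCycle_mul_swap_iff_of_not_sameCycle (π : Perm D) {a b z : D} (ha : ¬ π.SameCycle a z)
    (hb : ¬ π.SameCycle b z) (w : D) : (π * swap a b).SameCycle z w ↔ π.SameCycle z w := by
  constructor
  · intro h
    obtain ⟨k, hk⟩ := h.exists_nat_pow_eq
    rw [pow_mul_swap_apply_of_not_sameCycle π ha hb] at hk
    exact ⟨k, by rw [zpow_natCast, hk]⟩
  · intro h
    obtain ⟨k, hk⟩ := h.exists_nat_pow_eq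
    exact ⟨k, by rw [zpow_natCast, pow_mul_swap_apply_of_not_sameCycle π ha hb, hk]⟩

/-- **The merged relation, left-multiplication form.** If `a, b` lie in different cycles of `π`
then for all `z, w`:
`(swap a b * π).SameCycle z w ↔ π.SameCycle z w ∨ ((π.SameCycle a z ∨ π.SameCycle b z) ∧
(π.SameCycle a w ∨ π.SameCycle b w))`. -/
theorem sameCycle_swap_mul_iff_merge (π : Perm D) {a b : D} (hab : ¬ π.SameCycle a b) (z w : D) :
    (swap a b * π).SameCycle z w ↔
      π.SameCycle z w ∨
        ((π.SameCycle a z ∨ π.SameCycle b z) ∧ (π.SameCycle a w ∨ π.SameCycle b w)) := by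
  -- rewrite as a right multiplication by the swap of the predecessors
  set a' := π⁻¹ a with ha'
  set b' := π⁻¹ b with hb'
  have hconj : swap a b * π = π * swap a' b' := by
    rw [ha', hb', Equiv.mul_swap_eq_swap_mul]
    simp
  have haa : π.SameCycle a' a := by rw [ha']; exact ⟨1, by simp⟩
  have hbb : π.SameCycle b' b := by rw [hb']; exact ⟨1, by simp⟩
  have hab' : ¬ π.SameCycle a' b' := fun h => hab (haa.symm.trans (h.trans hbb))
  have ea : ∀ u, π.SameCycle a' u ↔ π.SameCycle a u := fun u =>
    ⟨fun h => haa.symm.trans h, fun h => haa.trans h⟩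
  have eb : ∀ u, π.SameCycle b' u ↔ π.SameCycle b u := fun u =>
    ⟨fun h => hbb.symm.trans h, fun h => hbb.trans h⟩
  rw [hconj]
  by_cases hz : π.SameCycle a' z ∨ π.SameCycle b' z
  · -- `z` is in the merged cycle
    have hz1 : (π * swap a' b').SameCycle a' z := (sameCycle_mul_swap_iff π hab' z).2 hz
    have hzA : π.SameCycle a z ∨ π.SameCycle b z := hz.imp (fun h => (ea z).1 h) (fun h => (eb z).1 h)
    constructor
    · intro h
      have hw := (sameCycle_mul_swap_iff π hab' w).1 (hz1.trans h)
      exact Or.inr ⟨hzA, hw.imp (fun h' => (ea w).1 h') (fun h' => (eb w).1 h')⟩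
    · rintro (h | ⟨-, hw⟩)
      · exact hz1.symm.trans ((sameCycle_mul_swap_iff π hab' w).2
          (hz.imp (fun h1 => h1.trans h) (fun h1 => h1.trans h)))
      · exact hz1.symm.trans ((sameCycle_mul_swap_iff π hab' w).2
          (hw.imp (fun h1 => (ea w).2 h1) (fun h1 => (eb w).2 h1)))
  · rw [not_or] at hz
    rw [sameCycle_mul_swap_iff_of_not_sameCycle π hz.1 hz.2]
    constructor
    · exact fun h => Or.inl h
    · rintro (h | ⟨hzA, -⟩)
      · exact h
      · exfalso
        rcases hzA with h1 | h1
        · exact hz.1 ((ea z).2 h1)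
        · exact hz.2 ((eb z).2 h1)

/-! ## Left multiplication by a transposition of two points in the same cycle (split) -/

/-- **Splitting lemma (the part we need).** If `a ≠ b` lie in the SAME cycle of `π`, then they
lie in DIFFERENT cycles of `swap a b * π`: the new orbit of `a` is `a, π a, …, π^{m−1} a` where
`π^m a = b` is the first visit of `b`. -/
theorem not_sameCycle_swap_mul_of_sameCycle (π : Perm D) {a b : D} (hne : a ≠ b)
    (hab : π.SameCycle a b) : ¬ (swap a b * π).SameCycle a b := by
  classical
  -- the first visit `m` of `b` on the orbit of `a`
  obtain ⟨m₀, -, hm₀⟩ := SameCycle.exists_lt_minimalPeriod hab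
  have hex : ∃ m, (π ^ m) a = b := ⟨m₀, hm₀⟩
  set m := Nat.find hex with hm
  have hmb : (π ^ m) a = b := Nat.find_spec hex
  have hmin : ∀ k < m, (π ^ k) a ≠ b := fun k hk => Nat.find_min hex hk
  have hm0 : 0 < m := by
    rcases Nat.eq_zero_or_pos m with h0 | h0
    · rw [h0, pow_zero, Perm.one_apply] at hmb
      exact absurd hmb hne
    · exact h0
  -- below `m` the orbit avoids `a` as well (else `a` would have period `< m` and never reach `b`)
  have hna : ∀ k, 0 < k → k < m → (π ^ k) a ≠ a := by
    intro k hk0 hkm hka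
    -- then `(π^m) a = (π^(m % k)) a`-style reduction: `b = (π^m) a = (π^(m-k)) a`, earlier visit
    have : (π ^ (m - k)) a = b := by
      have e : (π ^ (m - k)) ((π ^ k) a) = (π ^ m) a := by
        rw [← Perm.mul_apply, ← pow_add, Nat.sub_add_cancel hkm.le]
      rw [hka] at e
      rw [e, hmb]
    exact hmin (m - k) (Nat.sub_lt hm0 hk0) this
  -- the new permutation follows `π` on `a` for `k < m` steps and closes up at step `m`
  have hfollow : ∀ k, k < m → ((swap a b * π) ^ k) a = (π ^ k) a := by
    intro k hk
    induction k with
    | zero => simp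
    | succ k ih =>
      rw [pow_succ', Perm.mul_apply, ih (by omega), pow_succ', Perm.mul_apply, Perm.mul_apply]
      apply swap_apply_of_ne_of_ne
      · -- `π (π^k a) = (π^(k+1)) a ≠ a`
        have := hna (k + 1) (by omega) hk
        rwa [pow_succ', Perm.mul_apply] at this
      · have := hmin (k + 1) hk
        rwa [pow_succ', Perm.mul_apply] at this
  have hclose : ((swap a b * π) ^ m) a = a := by
    have hm1 : m = (m - 1) + 1 := by omega
    have hb' : π ((π ^ (m - 1)) a) = b := by
      rw [← Perm.mul_apply, ← pow_succ', ← hm1, hmb]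
    rw [hm1, pow_succ', Perm.mul_apply, hfollow (m - 1) (by omega), Perm.mul_apply, hb',
      swap_apply_right]
  -- so the new orbit of `a` has period dividing `m` and never meets `b`
  intro h
  obtain ⟨k, hk⟩ := h.exists_nat_pow_eq
  have hper : Function.IsPeriodicPt (swap a b * π) m a := by
    unfold Function.IsPeriodicPt Function.IsFixedPt
    rw [Equiv.Perm.iterate_eq_pow]
    exact hclose
  have hk' : ((swap a b * π) ^ (k % m)) a = b := by
    have := hper.iterate_mod_apply k
    rw [Equiv.Perm.iterate_eq_pow, Equiv.Perm.iterate_eq_pow] at this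
    rw [this, hk]
  rw [hfollow (k % m) (Nat.mod_lt _ hm0)] at hk'
  exact hmin (k % m) (Nat.mod_lt _ hm0) hk'


end RotSys

end Summit.Ventures.Crystal3D
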